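import Summits.MatrixMultiplication.OmegaCensus.STPPKernelListerScanSoundH
import Summits.MatrixMultiplication.OmegaCensus.STPPKernelListerBound

/-!
# ω-census (abelian STPP census): kernel lister — second-level split of the root computation (by first AND second block), with soundness (kernel)

HONEST FRAMING (pub-omega census; verbatim): lottery ticket; floor = certified bounds/negative ranges.
Census STRUCTURE (seat pub-omega-stpp-2 gen 29, 2026-08-29), family (b2).  Pure logic about a finite program; nothing here is progress on `ω`.

The kernel rejects single `decide`s of the heaviest first-block subtrees of the lister («excessive memory consumption»: first block `(2,3,3)` at `n = 61`,
3.6·10⁵ twin calls).  This file splits such a subtree once more: `addOneSel` is `addOne` whose continuation after every count of the first block only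
branches on NEXT blocks `t` with `sel2 t` (`scanFromS` / `scanFromC` = `scanFirstS` / `scanFirstC` started from an arbitrary state); `scanFirstSel2C sel1 sel2`
is the root computation restricted to first blocks in `sel1` and second blocks in `sel2`.  Selections combine by disjunction in BOTH arguments
(`scanFirstSel2C_or1`, `scanFirstSel2C_or2`), and with both selections covering every listed shape the computation is sound exactly like `scanFirstC`
(`scanFirstSel2C_soundH`).
-/

namespace Summit.MatrixMultiplication.OmegaCensus.KLister

/-! ## Definitions -/

/-- `scanFirstS` from an arbitrary state: branch on the next block `t ∈ ss` with `sel t` (at least one copy of `t`, then anything), for every `t`. [folklore] -/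
def scanFromS (n : ℕ) (dead : List (List Shape)) (sel : Shape → Bool) (rows : List ℕ) (kAfter : St → List Shape → Bool) :
    List Shape → St → List Shape → Bool
  | [], _, _ => true
  | t :: ss, st, P => (!(sel t) || addOne n dead (scanS n dead rows kAfter ss) t n st P) && scanFromS n dead sel rows kAfter ss st P

/-- `scanFirstC` from an arbitrary state. [folklore] -/
def scanFromC (n : ℕ) (dead : List (List Shape)) (sel : Shape → Bool) : List (List ℕ × List Shape) → St → List Shape → Bool
  | [], _, _ => true
  | (rows, ss) :: rest, st, P => scanFromS n dead sel rows (scanC n dead rest) ss st P && scanFromC n dead sel rest st P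

/-- `addOne` for a first block whose continuation only branches on second blocks in `sel2`. [folklore] -/
def addOneSel (n : ℕ) (dead : List (List Shape)) (sel2 : Shape → Bool) (rows : List ℕ) (rest : List (List ℕ × List Shape)) (ss : List Shape)
    (s : Shape) : ℕ → St → List Shape → Bool
  | 0, _, _ => true
  | fuel + 1, st, P =>
    !(st.fits n s) || Nat.blt (n + min st.mm (minprod s)) (st.vol + svol s) ||
      (let st' := st.add n s
       if n < st'.vol then leafOK n dead st' (P ++ [s]) else
         (scanFromS n dead sel2 rows (scanC n dead rest) ss st' (P ++ [s]) && scanFromC n dead sel2 rest st' (P ++ [s])) &&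
           addOneSel n dead sel2 rows rest ss s fuel st' (P ++ [s]))

/-- Root computation restricted to first blocks in `sel1` and second blocks in `sel2`, one chunk. [folklore] -/
def scanFirstSel2S (n : ℕ) (dead : List (List Shape)) (sel1 sel2 : Shape → Bool) (rows : List ℕ) (rest : List (List ℕ × List Shape)) :
    List Shape → Bool
  | [] => true
  | s :: ss => (!(sel1 s) || addOneSel n dead sel2 rows rest ss s n (St.init n) []) && scanFirstSel2S n dead sel1 sel2 rows rest ss

/-- Root computation restricted to first blocks in `sel1` and second blocks in `sel2`. [folklore] -/
def scanFirstSel2C (n : ℕ) (dead : List (List Shape)) (sel1 sel2 : Shape → Bool) : List (List ℕ × List Shape) → Bool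
  | [] => true
  | (rows, ss) :: rest => scanFirstSel2S n dead sel1 sel2 rows rest ss && scanFirstSel2C n dead sel1 sel2 rest

/-! ## Disjunction in the selections -/

variable {n : ℕ} {dead : List (List Shape)}

/-- `scanFromS` combines disjunctively in the selection. [folklore] -/
theorem scanFromS_or {a b : Shape → Bool} {rows : List ℕ} {k : St → List Shape → Bool} :
    ∀ (ss : List Shape) (st : St) (P : List Shape), scanFromS n dead a rows k ss st P = true → scanFromS n dead b rows k ss st P = true →
      scanFromS n dead (fun t => a t || b t) rows k ss st P = true := by
  intro ss
  induction ss with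
  | nil => intro _ _ _ _; rfl
  | cons t ss ih =>
    intro st P h1 h2
    rw [scanFromS, Bool.and_eq_true] at h1 h2 ⊢
    refine ⟨?_, ih st P h1.2 h2.2⟩
    have a1 := h1.1; have a2 := h2.1
    rw [Bool.or_eq_true] at a1 a2 ⊢
    cases ha : a t <;> cases hb : b t <;> simp_all

/-- `scanFromC` combines disjunctively in the selection. [folklore] -/
theorem scanFromC_or {a b : Shape → Bool} :
    ∀ (L : List (List ℕ × List Shape)) (st : St) (P : List Shape), scanFromC n dead a L st P = true → scanFromC n dead b L st P = true →
      scanFromC n dead (fun t => a t || b t) L st P = true := by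
  intro L
  induction L with
  | nil => intro _ _ _ _; rfl
  | cons ch rest ih =>
    obtain ⟨rows, ss⟩ := ch
    intro st P h1 h2
    rw [scanFromC, Bool.and_eq_true] at h1 h2 ⊢
    exact ⟨scanFromS_or ss st P h1.1 h2.1, ih st P h1.2 h2.2⟩

/-- `addOneSel` combines disjunctively in `sel2`. [folklore] -/
theorem addOneSel_or {a b : Shape → Bool} {rows : List ℕ} {rest : List (List ℕ × List Shape)} {ss : List Shape} {s : Shape} :
    ∀ (fuel : ℕ) (st : St) (P : List Shape), addOneSel n dead a rows rest ss s fuel st P = true → addOneSel n dead b rows rest ss s fuel st P = true →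
      addOneSel n dead (fun t => a t || b t) rows rest ss s fuel st P = true := by
  intro fuel
  induction fuel with
  | zero => intro _ _ _ _; rfl
  | succ fuel ih =>
    intro st P h1 h2
    rw [addOneSel] at h1 h2 ⊢
    cases hfit : st.fits n s with
    | false => simp
    | true =>
      rw [hfit] at h1 h2
      simp only [Bool.not_true, Bool.false_or, Bool.or_eq_true] at h1 h2 ⊢
      rcases h1 with h1 | h1
      · exact Or.inl h1
      rcases h2 with h2 | h2
      · exact Or.inl h2
      right
      by_cases hb : n < (st.add n s).vol
      · rw [if_pos hb] at h1 h2 ⊢; exact h1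
      · rw [if_neg hb, Bool.and_eq_true, Bool.and_eq_true] at h1 h2 ⊢
        exact ⟨⟨scanFromS_or _ _ _ h1.1.1 h2.1.1, scanFromC_or _ _ _ h1.1.2 h2.1.2⟩, ih _ _ h1.2 h2.2⟩

/-- `scanFirstSel2S` combines disjunctively in `sel2`. [folklore] -/
theorem scanFirstSel2S_or2 {s1 a b : Shape → Bool} {rows : List ℕ} {rest : List (List ℕ × List Shape)} :
    ∀ ss : List Shape, scanFirstSel2S n dead s1 a rows rest ss = true → scanFirstSel2S n dead s1 b rows rest ss = true →
      scanFirstSel2S n dead s1 (fun t => a t || b t) rows rest ss = true := by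
  intro ss
  induction ss with
  | nil => intro _ _; rfl
  | cons s ss ih =>
    intro h1 h2
    rw [scanFirstSel2S, Bool.and_eq_true] at h1 h2 ⊢
    refine ⟨?_, ih h1.2 h2.2⟩
    have a1 := h1.1; have a2 := h2.1
    rw [Bool.or_eq_true] at a1 a2 ⊢
    cases hs : s1 s with
    | false => left; rfl
    | true =>
      rw [hs] at a1 a2; simp only [Bool.not_true, Bool.false_eq_true, false_or] at a1 a2
      exact Or.inr (addOneSel_or _ _ _ a1 a2)

/-- `scanFirstSel2C` combines disjunctively in `sel2`. [folklore] -/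
theorem scanFirstSel2C_or2 {s1 a b : Shape → Bool} :
    ∀ L : List (List ℕ × List Shape), scanFirstSel2C n dead s1 a L = true → scanFirstSel2C n dead s1 b L = true →
      scanFirstSel2C n dead s1 (fun t => a t || b t) L = true := by
  intro L
  induction L with
  | nil => intro _ _; rfl
  | cons ch rest ih =>
    obtain ⟨rows, ss⟩ := ch
    intro h1 h2
    rw [scanFirstSel2C, Bool.and_eq_true] at h1 h2 ⊢
    exact ⟨scanFirstSel2S_or2 ss h1.1 h2.1, ih h1.2 h2.2⟩

/-- `scanFirstSel2S` combines disjunctively in `sel1`. [folklore] -/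
theorem scanFirstSel2S_or1 {a b s2 : Shape → Bool} {rows : List ℕ} {rest : List (List ℕ × List Shape)} :
    ∀ ss : List Shape, scanFirstSel2S n dead a s2 rows rest ss = true → scanFirstSel2S n dead b s2 rows rest ss = true →
      scanFirstSel2S n dead (fun t => a t || b t) s2 rows rest ss = true := by
  intro ss
  induction ss with
  | nil => intro _ _; rfl
  | cons s ss ih =>
    intro h1 h2
    rw [scanFirstSel2S, Bool.and_eq_true] at h1 h2 ⊢
    refine ⟨?_, ih h1.2 h2.2⟩
    have a1 := h1.1; have a2 := h2.1
    rw [Bool.or_eq_true] at a1 a2 ⊢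
    cases ha : a s <;> cases hb : b s <;> simp_all

/-- `scanFirstSel2C` combines disjunctively in `sel1`. [folklore] -/
theorem scanFirstSel2C_or1 {a b s2 : Shape → Bool} :
    ∀ L : List (List ℕ × List Shape), scanFirstSel2C n dead a s2 L = true → scanFirstSel2C n dead b s2 L = true →
      scanFirstSel2C n dead (fun t => a t || b t) s2 L = true := by
  intro L
  induction L with
  | nil => intro _ _; rfl
  | cons ch rest ih =>
    obtain ⟨rows, ss⟩ := ch
    intro h1 h2
    rw [scanFirstSel2C, Bool.and_eq_true] at h1 h2 ⊢
    exact ⟨scanFirstSel2S_or1 ss h1.1 h2.1, ih h1.2 h2.2⟩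

/-! ## Soundness -/

variable {Bad : List Shape → Prop} {Inv : St → List Shape → Prop} {Cov : List ℕ → List Shape → Prop} {U : List Shape}

/-- Specification of a «from-state» scan for the remaining list `R`: the EMPTY extension and every extension whose first block is selected are excluded.
[folklore] -/
def FromSpec (Bad : List Shape → Prop) (sel : Shape → Bool) (P : List Shape) (R : List Shape) : Prop :=
  ∀ E, OrdExt R E → (E = [] ∨ ∃ t E', E = t :: E' ∧ sel t = true) → ¬ Bad (P ++ E)

/-- **Soundness of `scanFromS`.** [folklore] -/
theorem scanFromS_soundH (H : SearchHypH n dead U Bad Inv Cov) {sel : Shape → Bool} {rows : List ℕ} {kAfter : St → List Shape → Bool} {Rafter : List Shape}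
    (hk : KSpecH n Bad Inv kAfter Rafter) {st : St} {P : List Shape} (hI : Inv st P)
    (hlater : FromSpec Bad sel P Rafter) :
    ∀ ss : List Shape, (∀ x ∈ ss, x ∈ U) → Cov rows (ss ++ Rafter) → scanFromS n dead sel rows kAfter ss st P = true →
      FromSpec Bad sel P (ss ++ Rafter) := by
  intro ss
  induction ss with
  | nil => intro _ _ _ E hE hc; exact hlater E (by simpa using hE) hc
  | cons t ss ih =>
    intro hU hcov h E hE hc
    rw [scanFromS, Bool.and_eq_true] at h
    obtain ⟨h0, h1⟩ := h
    have hcov' : Cov rows (ss ++ Rafter) := H.cov_tail rows t _ (by simpa using hcov)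
    have hU' : ∀ x ∈ ss, x ∈ U := fun x hx => hU x (List.mem_cons_of_mem _ hx)
    have hE' : OrdExt (t :: (ss ++ Rafter)) E := by simpa using hE
    rcases hE'.cons_cases with hR | ⟨E'', hEE, hE''⟩
    · exact ih hU' hcov' h1 E hR hc
    · rcases hc with hc | ⟨t', E', hEq, hsel⟩
      · rw [hc] at hEE; exact absurd hEE (by simp)
      · rw [hEq] at hEE
        obtain ⟨htt, hEqq⟩ := List.cons.inj hEE
        subst htt
        rw [hsel] at h0
        simp only [Bool.not_true, Bool.false_or] at h0
        have hks : KSpecH n Bad Inv (scanS n dead rows kAfter ss) (ss ++ Rafter) := scanS_soundH H hk ss hU' hcov'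
        have := addOne_soundH H (hU t' List.mem_cons_self) hks n st P hI (by omega) h0 E'' hE''
        rw [hEq, hEqq]; exact this

/-- **Soundness of `scanFromC`.** [folklore] -/
theorem scanFromC_soundH (H : SearchHypH n dead U Bad Inv Cov) {sel : Shape → Bool} {st : St} {P : List Shape} (hI : Inv st P) (hv : st.vol ≤ n) :
    ∀ L : List (List ℕ × List Shape), (∀ x ∈ flat L, x ∈ U) → ChunksCov Cov L → scanFromC n dead sel L st P = true → FromSpec Bad sel P (flat L) := by
  intro L
  induction L with
  | nil =>
    intro _ _ _ E hE _
    have : E = [] := OrdExt.eq_nil (by simpa [flat] using hE)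
    subst this; simpa using H.nonbeating st P hI hv
  | cons ch rest ih =>
    obtain ⟨rows, ss⟩ := ch
    intro hU hc h E hE hcase
    rw [ChunksCov] at hc
    rw [scanFromC, Bool.and_eq_true] at h
    rw [flat_cons] at hE hU
    have hUr : ∀ x ∈ flat rest, x ∈ U := fun x hx => hU x (List.mem_append_right _ hx)
    exact scanFromS_soundH H (scanC_soundH H rest hUr hc.2) hI (ih hUr hc.2 h.2) ss (fun x hx => hU x (List.mem_append_left _ hx)) hc.1 h.1 E hE hcase

/-- **Soundness of `addOneSel`** when `sel2` covers every shape of the remaining list. [folklore] -/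
theorem addOneSel_soundH (H : SearchHypH n dead U Bad Inv Cov) {sel2 : Shape → Bool} {rows : List ℕ} {rest : List (List ℕ × List Shape)} {ss : List Shape}
    {s : Shape} (hs : s ∈ U) (hU : ∀ x ∈ ss ++ flat rest, x ∈ U) (hsel : ∀ x ∈ ss ++ flat rest, sel2 x = true) (hcovS : Cov rows (ss ++ flat rest))
    (hcovC : ChunksCov Cov rest) :
    ∀ (fuel : ℕ) (st : St) (P : List Shape), Inv st P → n ≤ fuel + st.sab → addOneSel n dead sel2 rows rest ss s fuel st P = true →
      ∀ E', OrdExt (s :: (ss ++ flat rest)) E' → ¬ Bad (P ++ s :: E') := by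
  intro fuel
  induction fuel with
  | zero => intro st P hI hf _ E' _; exact H.exhausted st P s E' hs hI (by simpa using hf)
  | succ fuel ih =>
    intro st P hI hf h E' hE'
    rw [addOneSel] at h
    cases hfit : st.fits n s with
    | false => exact H.misfit st P s E' hs hI hfit
    | true =>
      rw [hfit] at h
      simp only [Bool.not_true, Bool.false_or, Bool.or_eq_true] at h
      rcases h with h | h
      · exact H.overshoot st P s E' hs hI (by simpa [Nat.blt_eq] using h)
      · obtain ⟨hI', hsab, hh0⟩ := H.add st P s hs hI hfit
        by_cases hb : n < (st.add n s).vol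
        · rw [if_pos hb] at h
          by_cases hE : E' = []
          · subst hE; exact H.leaf _ _ hI' hb h
          · have := H.prefix_beating _ _ E' hI' hb hE
            simpa [List.append_assoc] using this
        · rw [if_neg hb, Bool.and_eq_true, Bool.and_eq_true] at h
          obtain ⟨⟨hkS, hkC⟩, hrec⟩ := h
          have hvol : (st.add n s).vol ≤ n := Nat.le_of_not_lt hb
          rcases hE'.cons_cases with hR | ⟨E'', rfl, hE''⟩
          · -- no further copy of `s`: the extension continues in `ss ++ flat rest`, empty or with a selected first block
            have hUr : ∀ x ∈ flat rest, x ∈ U := fun x hx => hU x (List.mem_append_right _ hx)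
            have hFromC := scanFromC_soundH H hI' hvol rest hUr hcovC hkC
            have hFromS := scanFromS_soundH H (scanC_soundH H rest hUr hcovC) hI' hFromC ss
              (fun x hx => hU x (List.mem_append_left _ hx)) hcovS hkS
            have hcase : E' = [] ∨ ∃ t E'', E' = t :: E'' ∧ sel2 t = true := by
              cases E' with
              | nil => exact Or.inl rfl
              | cons t E'' => exact Or.inr ⟨t, E'', rfl, hsel t (hR.mem t List.mem_cons_self)⟩
            have := hFromS E' hR hcase
            simpa [List.append_assoc] using this
          · have hf' : n ≤ fuel + (st.add n s).sab := by omega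
            have := ih (st.add n s) (P ++ [s]) hI' hf' hrec E'' hE''
            simpa [List.append_assoc] using this

/-- **Soundness of `scanFirstSel2S`** (one chunk) with `sel2` covering the remaining shapes. [folklore] -/
theorem scanFirstSel2S_soundH (H : SearchHypH n dead U Bad Inv Cov) (hinit : Inv (St.init n) []) {sel1 sel2 : Shape → Bool} {rows : List ℕ}
    {rest : List (List ℕ × List Shape)} (hUr : ∀ x ∈ flat rest, x ∈ U) (hcovC : ChunksCov Cov rest)
    (hlater : ∀ E, OrdExt (flat rest) E → ∀ s E', E = s :: E' → sel1 s = true → ¬ Bad E) :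
    ∀ ss : List Shape, (∀ x ∈ ss, x ∈ U) → (∀ x ∈ ss ++ flat rest, sel2 x = true) → Cov rows (ss ++ flat rest) →
      scanFirstSel2S n dead sel1 sel2 rows rest ss = true → ∀ E, OrdExt (ss ++ flat rest) E → ∀ s E', E = s :: E' → sel1 s = true → ¬ Bad E := by
  intro ss
  induction ss with
  | nil => intro _ _ _ _ E hE s E' hEs hsel; exact hlater E (by simpa using hE) s E' hEs hsel
  | cons t ss ih =>
    intro hU hsel2 hcov h E hE s E' hEs hsel
    rw [scanFirstSel2S, Bool.and_eq_true] at h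
    obtain ⟨h0, h1⟩ := h
    have hcov' : Cov rows (ss ++ flat rest) := H.cov_tail rows t _ (by simpa using hcov)
    have hU' : ∀ x ∈ ss, x ∈ U := fun x hx => hU x (List.mem_cons_of_mem _ hx)
    have hsel2' : ∀ x ∈ ss ++ flat rest, sel2 x = true := fun x hx => hsel2 x (by simp only [List.cons_append, List.mem_cons]; exact Or.inr hx)
    have hE' : OrdExt (t :: (ss ++ flat rest)) E := by simpa using hE
    rcases hE'.cons_cases with hR | ⟨E'', hEE, hE''⟩
    · exact ih hU' hsel2' hcov' h1 E hR s E' hEs hsel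
    · subst hEs
      obtain ⟨hst, hEq⟩ := List.cons.inj hEE
      subst hst; subst hEq
      rw [hsel] at h0
      simp only [Bool.not_true, Bool.false_or] at h0
      have hUall : ∀ x ∈ ss ++ flat rest, x ∈ U := fun x hx => by
        rcases List.mem_append.1 hx with hx | hx
        · exact hU' x hx
        · exact hUr x hx
      have hsab : (St.init n).sab = 0 := rfl
      have := addOneSel_soundH H (hU s List.mem_cons_self) hUall hsel2' hcov' hcovC n (St.init n) [] hinit (by rw [hsab]; omega) h0 E' hE''
      simpa using this

/-- **Soundness of `scanFirstSel2C`**: with every listed shape in `U` and selected by `sel2`, `scanFirstSel2C n dead sel1 sel2 L = true` excludes every bad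
non-empty pattern in list order whose first block satisfies `sel1`. [folklore] -/
theorem scanFirstSel2C_soundH (H : SearchHypH n dead U Bad Inv Cov) (hinit : Inv (St.init n) []) {sel1 sel2 : Shape → Bool} :
    ∀ L : List (List ℕ × List Shape), (∀ x ∈ flat L, x ∈ U) → (∀ x ∈ flat L, sel2 x = true) → ChunksCov Cov L → scanFirstSel2C n dead sel1 sel2 L = true →
      ∀ E, OrdExt (flat L) E → ∀ s E', E = s :: E' → sel1 s = true → ¬ Bad E := by
  intro L
  induction L with
  | nil =>
    intro _ _ _ _ E hE s E' hEs _
    have : E = [] := OrdExt.eq_nil (by simpa [flat] using hE)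
    rw [this] at hEs; exact absurd hEs (by simp)
  | cons ch rest ih =>
    obtain ⟨rows, ss⟩ := ch
    intro hU hsel2 hc h E hE s E' hEs hsel
    rw [ChunksCov] at hc
    rw [scanFirstSel2C, Bool.and_eq_true] at h
    rw [flat_cons] at hE hU hsel2
    have hUr : ∀ x ∈ flat rest, x ∈ U := fun x hx => hU x (List.mem_append_right _ hx)
    exact scanFirstSel2S_soundH H hinit hUr hc.2 (ih hUr (fun x hx => hsel2 x (List.mem_append_right _ hx)) hc.2 h.2) ss
      (fun x hx => hU x (List.mem_append_left _ hx)) hsel2 hc.1 h.1 E hE s E' hEs hsel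

end Summit.MatrixMultiplication.OmegaCensus.KLister
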